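import Literature.AlgebraicGeometry.Motives.HodgeStructureRealMultiplicationCompatiblePolarization
import Literature.AlgebraicGeometry.Motives.HodgeStructureCMGaloisFormOrthogonality
import Literature.AlgebraicGeometry.Motives.HodgeStructureCMSesquilinearFormGalois
import Literature.AlgebraicGeometry.Motives.HodgeStructureLefschetzGroupEigenspaceSplitting
import Literature.AlgebraicGeometry.Motives.HodgeStructureLefschetzGroupTraceTransfer
import HarnessLib

/-!
# Real multiplication splits a polarization into orthogonal blocks, and transfers it to a `(-1)ⁿ`-symmetric `K`-BILINEAR form
# (Totaro 2015 §2: the `(-1)^m`-hermitian form `(,) : V × V → E` «is a bilinear form if `E` is totally real»; Milne 1999 §2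
# type I: «`φᵢ` is a nondegenerate skew-symmetric form on the `Fᵢ`-vector space `Vᵢ`») — HYPOTHESIS-FREE for every
# polarizable `ℚ`-Hodge structure with an action of a totally real field, through Totaro's Lemma 2.1

[topic AlgebraicGeometry/Motives]

Layer `Literature/AlgebraicGeometry/Motives`, namespace `Literature.AlgebraicGeometry.Motives.HodgeStructure`; lane
`lit-hodgefound` (Track 2 foundations library), prover seat `lit-hodgefound-p02`, generation 48, self-proposed row g48-#7 of
`run/shared/lean/pub/lit-hodgefound/SKELETON.md`; sequel of g48-#6 `Motives/HodgeStructureRealMultiplicationCompatiblePolarization`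
(Totaro's Lemma 2.1, totally real half: `∃ ψ, ψ(ι(u)v, w) = ψ(v, ι(u)w)`). THEOREMS ONLY: no definition, no instance, no notation,
no named fact (D-0026 net debt `0`).

The tree's Milne / Deligne files state their «type I» results UNDER THE HYPOTHESIS `hsym : ∀ a v w, Q(ι(a)v, w) = Q(v, ι(a)w)`
(«Type I: `E` is a totally real field, and the Rosati involutions are trivial»): `Motives/HodgeStructureLefschetzGroupEigenspaceSplitting`
(`Polarization.baseChange_form_eq_zero_of_mem_eigenspaceBaseChange_of_ne`, `Polarization.baseChange_form_eq_sum_blocks`),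
`Motives/HodgeStructureLefschetzGroupTraceTransfer` (`Polarization.hermitianTransfer_apply_right_of_forall_form_ι`,
`Polarization.hermitianTransfer_swap_of_forall_form_ι`), and the CM files state the orthogonality of the `σ`-blocks through a
«Galois form» hypothesis (`Motives/HodgeStructureCMSesquilinearFormGalois.galois_of_sesquilinear'`,
`Motives/HodgeStructureCMGaloisFormOrthogonality.galois_form_eq_zero_of_ne_conjugate`). This file (§1) proves the block
orthogonality for ANY `K`-balanced bilinear form and ANY number field `K`, and (§2–§3) discharges `hsym` for SOME polarization whenever
`K` is totally real (g48-#6), so that the type-I conclusions hold for every polarizable `ℚ`-Hodge structure with real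
multiplication — in particular for a totally real field `K ⊊ E_φ` that a given Rosati involution need not fix.

## The sources, verbatim

* B. Totaro, *Hodge structures of type `(n,0,…,0,n)`*, IMRN 2015 [Totaro2015HodgeStructuresN00N] (held `paper:arxiv-1402.3666`),
  §2 p0004: «Let `E` be a totally real or CM field, and let `V` be a polarized `E`-Hodge structure of weight `m`. Then there is a
  unique `(-1)^m`-hermitian form `(,) : V × V → E` such that `⟨x,y⟩ = tr^E_ℚ (x,y)`. By a `(-1)^m`-hermitian form, we mean that
  `(ax,y) = a(x,y)`, `(x,ay) = ā(x,y)`, and `(x,y) = (-1)^m \overline{(y,x)}` for `x,y ∈ V` and `a ∈ E`; thus `(,)` is a bilinear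
  form if `E` is totally real. The existence and uniqueness of `(,)` follow by observing that […] `a, b ↦ tr^L_ℚ(ab)` is a
  nondegenerate bilinear form»; Lemma 2.1 p0005 («Then `V` is polarizable as a `K`-Hodge structure»); §3 p0007: «`F ⊗_ℚ ℂ` is the
  product of copies of `ℂ` indexed by the embeddings `σ₁,…,σ_g : F ↪ ℝ`. Each summand `V^{b,c}` of `V ⊗_ℚ ℂ` is a module over
  `F ⊗_ℚ ℂ`. So `V^{b,c}` splits as a direct sum of complex linear subspaces on which `F` acts by `σ₁,…,σ_g`, respectively.»
* J. S. Milne, *Lefschetz classes on abelian varieties*, Duke Math. J. 96 (1999) [Milne1999LefschetzClasses], §2 p. 645 L32: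
  «Type I: `E` is a totally real field, and the Rosati involutions are trivial»; p. 648 L37–L55: «let `φ : V(A) × V(A) → F ⊗_ℚ k`
  be the skew-symmetric form such that `Tr_{F⊗k/k} ∘ φ = e_D` […] `φᵢ` is a nondegenerate skew-symmetric form on the `Fᵢ`-vector
  space `Vᵢ`»; p. 646 L43–L52 («`V(A) = V₁ ⊕ ⋯ ⊕ V_t`, `Vᵢ = eᵢV`»).
* F. Hazama, *Algebraic cycles on abelian varieties with many real endomorphisms*, Tôhoku Math. J. 35 (1983) [Hazama1983] §3
  p. 305 (the decomposition `H¹(A, ℂ) = ⊕ Vᵢ` under `End⁰A ⊗ ℂ`, blocks of distinct characters orthogonal for the polarization —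
  as read in the tree's `Motives/HodgeLieRealPlacesSl2.form_eq_zero_of_mem_eigenBlock_of_isAdjointPair`); P. Deligne [Deligne1982HodgeCycles] §4
  («`H ⊗ ℂ = ⊕_σ H_σ`», Sublemma 4.7).

## What is proved (`A : EndAction H K`, `V_σ = ⋂_e ker((ι e)_ℂ − σ(e))` for `σ : K → ℂ`, `V^{p,q}_σ = A.eigenPiece σ p q`)

* §1 BALANCED FORMS, any number field `K`, any bilinear `ψ` with `ψ(ι(e)v, w) = ψ(v, ι(e)w)`:
  **`form_baseChange_eq_zero_of_forall_form_ι_of_ne`** (`V_σ ⊥_{ψ_ℂ} V_τ` for `σ ≠ τ`: `σ(e)ψ_ℂ(x,y) = ψ_ℂ(ι(e)x, y) =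
  ψ_ℂ(x, ι(e)y) = τ(e)ψ_ℂ(x,y)`), `form_baseChange_eigenPiece_eq_zero_of_forall_form_ι_of_ne` (the same for `V^{p,q}_σ`,
  `V^{p',q'}_τ`); for `K` TOTALLY REAL also the hermitian reading **`galois_of_forall_form_ι_of_isTotallyReal`**
  (`ψ_ℂ(x, ȳ) = 0` for `x ∈ V_σ`, `y ∈ V_τ`, `σ ≠ τ` — the «Galois form» hypothesis of the CM files, through
  `galois_of_sesquilinear'` with `ρ = id`, every embedding of `K` being real).
* §2 EXISTENCE for `K` TOTALLY REAL and `H` polarizable (Lemma 2.1 of g48-#6 feeds `hsym`):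
  **`exists_polarization_forall_iInf_eigenspace_orthogonal`** (`∃ ψ : Polarization H`, `K`-balanced, with `V_σ ⊥ V_τ` and
  `ψ_ℂ(V_σ, \overline{V_τ}) = 0` for all `σ ≠ τ`), **`exists_polarization_forall_eigenspaceBaseChange_orthogonal`** (on `K'`-points
  for any field `K' ⊇ ℚ`: the blocks `V_{K',χ}`, `χ ≠ χ' : K → K'`, are `ψ_{K'}`-orthogonal — Milne's «`V(A) = V₁ ⊕ ⋯ ⊕ V_t`»),
  `exists_polarization_baseChange_form_eq_sum_blocks` (`ψ_{K'}(x,y) = Σ_s ψ_{K'}(π_s x, π_s y)` when `K'` admits all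
  `[K:ℚ]` embeddings).
* §3 THE TRANSFER (Totaro p0004 / Milne type I): **`exists_polarization_hermitianTransfer_bilinear`** — `∃ ψ : Polarization H` whose
  transfer `Ψ = ψ.hermitianTransfer A : V × V → K` (the unique pairing with `Tr_{K/ℚ} ∘ Ψ = ψ` that is `K`-linear in the first
  variable) is `K`-BILINEAR (`Ψ(v, ι(a)w) = aΨ(v,w)`) and `(-1)ⁿ`-SYMMETRIC (`Ψ(w,v) = (-1)ⁿΨ(v,w)`); with `[Module.Finite ℚ V]`
  also NONDEGENERATE (`exists_polarization_hermitianTransfer_bilinear_nondegenerate`).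

Honest column: «`V` polarizable as a `K`-Hodge structure» is read, as in g48-#6, as the balance identity; the uniqueness of `(,)` is
the tree's `Polarization.eq_hermitianTransfer` and is not restated.
-/

noncomputable section

open Module NumberField
open scoped TensorProduct

universe u v w

namespace Literature.AlgebraicGeometry.Motives.HodgeStructure

variable {V : Type u} [AddCommGroup V] [Module ℚ V] {n : ℤ} {H : HodgeStructure V n}
variable {K : Type v} [Field K] [NumberField K]

namespace EndAction

/-! ## §1 A `K`-balanced form pairs `V_σ` only with `V_σ` -/

section Balanced

variable (A : EndAction H K) (ψ : LinearMap.BilinForm ℚ V)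

/-- **`V_σ ⊥ V_τ` for `σ ≠ τ` under a `K`-balanced form**: if `ψ(ι(e)v, w) = ψ(v, ι(e)w)` for all `e`, then `ψ_ℂ(x, y) = 0` for
`x ∈ V_σ`, `y ∈ V_τ`, `σ ≠ τ` (`σ(e)ψ_ℂ(x,y) = ψ_ℂ((ι e)x, y) = ψ_ℂ(x, (ι e)y) = τ(e)ψ_ℂ(x,y)`). Any number field `K`.
[cite: Milne1999LefschetzClasses, §2 p. 648 L43–L48 and p. 649 L1–L8 (type I: the blocks are orthogonal)] [cite: Hazama1983, §3 (p. 305)]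
[cite: Deligne1982HodgeCycles, §4 («H ⊗ ℂ = ⊕_σ H_σ»)] -/
theorem form_baseChange_eq_zero_of_forall_form_ι_of_ne (hsym : ∀ (e : K) (v w : V), ψ (A.ι e v) w = ψ v (A.ι e w))
    {σ τ : K →+* ℂ} (hστ : σ ≠ τ) {x y : ℂ ⊗[ℚ] V} (hx : x ∈ ⨅ e, Module.End.eigenspace ((A.ι e).baseChange ℂ) (σ e))
    (hy : y ∈ ⨅ e, Module.End.eigenspace ((A.ι e).baseChange ℂ) (τ e)) : ψ.baseChange ℂ x y = 0 := by
  obtain ⟨e, he⟩ : ∃ e, σ e ≠ τ e := by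
    by_contra h
    exact hστ (RingHom.ext fun e ↦ not_ne_iff.mp (not_exists.mp h e))
  have h1 := A.form_baseChange_eigen_smul ψ hx e y
  rw [bilinForm_baseChange_apply_baseChange ψ (A.ι e) (A.ι e) (hsym e) x y, (A.mem_iInf_eigenspace_iff τ y).1 hy e, map_smul,
    smul_eq_mul] at h1
  have h2 : (σ e - τ e) * ψ.baseChange ℂ x y = 0 := by rw [sub_mul, h1, sub_self]
  exact (mul_eq_zero.1 h2).resolve_left (sub_ne_zero.2 he)

/-- The same for the Hodge eigen-pieces: `ψ_ℂ(V^{p,q}_σ, V^{p',q'}_τ) = 0` for `σ ≠ τ` («`V^{b,c}` splits as a direct sum of complex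
linear subspaces on which `F` acts by `σ₁,…,σ_g`»). [cite: Totaro2015HodgeStructuresN00N, §3 (arXiv p0007)]
[cite: Milne1999LefschetzClasses, §2 p. 648 L43–L48] -/
theorem form_baseChange_eigenPiece_eq_zero_of_forall_form_ι_of_ne (hsym : ∀ (e : K) (v w : V), ψ (A.ι e v) w = ψ v (A.ι e w))
    {σ τ : K →+* ℂ} (hστ : σ ≠ τ) {p q p' q' : ℤ} {x y : ℂ ⊗[ℚ] V} (hx : x ∈ A.eigenPiece σ p q)
    (hy : y ∈ A.eigenPiece τ p' q') : ψ.baseChange ℂ x y = 0 :=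
  A.form_baseChange_eq_zero_of_forall_form_ι_of_ne ψ hsym hστ (A.eigenPiece_le_iInf_eigenspace σ p q hx)
    (A.eigenPiece_le_iInf_eigenspace τ p' q' hy)

/-- **For `K` TOTALLY REAL a `K`-balanced form is a «Galois form»**: `ψ_ℂ(x, ȳ) = 0` for `x ∈ V_σ`, `y ∈ V_τ`, `σ ≠ τ` (every
embedding of `K` is real, so `ȳ ∈ V_τ` again; the tree's `galois_of_sesquilinear'` with `ρ = id`).
[cite: Totaro2015HodgeStructuresN00N, §2 Lemma 2.1 (arXiv p0005: «ā … is the identity if K is totally real») and §3 (p0007: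
«a(x̄) = \overline{ax} = σ_j(a)x̄ … uses that σ_j(a) is real»)] [cite: Deligne1982HodgeCycles, §4] -/
theorem galois_of_forall_form_ι_of_isTotallyReal [IsTotallyReal K]
    (hsym : ∀ (e : K) (v w : V), ψ (A.ι e v) w = ψ v (A.ι e w)) :
    ∀ ⦃σ τ : K →+* ℂ⦄, σ ≠ τ → ∀ ⦃x y : ℂ ⊗[ℚ] V⦄,
      x ∈ (⨅ e, Module.End.eigenspace ((A.ι e).baseChange ℂ) (σ e)) →
      y ∈ (⨅ e, Module.End.eigenspace ((A.ι e).baseChange ℂ) (τ e)) → ψ.baseChange ℂ x (conj y) = 0 :=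
  A.galois_of_sesquilinear' ψ (ρ := id) (fun φ e ↦ by
    rw [id, ← ComplexEmbedding.conjugate_coe_eq φ e, ComplexEmbedding.isReal_iff.1 (IsTotallyReal.complexEmbedding_isReal φ)])
    hsym

end Balanced

/-! ## §2 Existence for a totally real field acting on a polarizable Hodge structure -/

section Existence

variable [IsTotallyReal K] (A : EndAction H K)

/-- **A POLARIZATION WITH ORTHOGONAL `σ`-BLOCKS EXISTS** for every polarizable `ℚ`-Hodge structure with an action of a totally real
field `K`: some polarization `ψ` is `K`-balanced, and then `V_σ ⊥_{ψ_ℂ} V_τ` and `ψ_ℂ(V_σ, \overline{V_τ}) = 0` for all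
`σ ≠ τ : K → ℂ` («`V^{b,c}` splits as a direct sum … on which `F` acts by `σ₁,…,σ_g`», now `ψ`-orthogonally).
[cite: Totaro2015HodgeStructuresN00N, §2 Lemma 2.1 (arXiv p0005) and §3 (p0007)] [cite: Milne1999LefschetzClasses, §2 p. 646 L43–L52 («V(A) = V₁ ⊕ ⋯ ⊕ V_t»)] -/
theorem exists_polarization_forall_iInf_eigenspace_orthogonal (hpol : H.IsPolarizable) :
    ∃ ψ : Polarization H, (∀ (u : K) (v w : V), ψ.form (A.ι u v) w = ψ.form v (A.ι u w)) ∧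
      ∀ ⦃σ τ : K →+* ℂ⦄, σ ≠ τ → ∀ ⦃x y : ℂ ⊗[ℚ] V⦄,
        x ∈ (⨅ e, Module.End.eigenspace ((A.ι e).baseChange ℂ) (σ e)) →
        y ∈ (⨅ e, Module.End.eigenspace ((A.ι e).baseChange ℂ) (τ e)) →
          ψ.form.baseChange ℂ x y = 0 ∧ ψ.form.baseChange ℂ x (conj y) = 0 := by
  obtain ⟨ψ, hψ⟩ := A.exists_polarization_form_apply_ι hpol
  exact ⟨ψ, hψ, fun σ τ hστ x y hx hy ↦ ⟨A.form_baseChange_eq_zero_of_forall_form_ι_of_ne ψ.form hψ hστ hx hy,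
    A.galois_of_forall_form_ι_of_isTotallyReal ψ.form hψ hστ hx hy⟩⟩

/-- **On `K'`-points, for any field `K' ⊇ ℚ`**: some polarization `ψ` is `K`-balanced and its base change `ψ_{K'}` makes the
blocks `V_{K',χ}` (`χ ≠ χ' : K → K'`) orthogonal — Milne's type-I orthogonal splitting «`V(A) = V₁ ⊕ ⋯ ⊕ V_t`» without the
hypothesis «the Rosati involutions are trivial». [cite: Milne1999LefschetzClasses, §2 p. 646 L43–L52 and p. 648 L43–L48]
[cite: Totaro2015HodgeStructuresN00N, §2 Lemma 2.1 (arXiv p0005)] -/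
theorem exists_polarization_forall_eigenspaceBaseChange_orthogonal (K' : Type w) [Field K'] [Algebra ℚ K']
    (hpol : H.IsPolarizable) :
    ∃ ψ : Polarization H, (∀ (u : K) (v w : V), ψ.form (A.ι u v) w = ψ.form v (A.ι u w)) ∧
      ∀ ⦃χ χ' : K →ₐ[ℚ] K'⦄, χ ≠ χ' → ∀ ⦃x y : K' ⊗[ℚ] V⦄, x ∈ A.eigenspaceBaseChange K' χ →
        y ∈ A.eigenspaceBaseChange K' χ' → ψ.form.baseChange K' x y = 0 := by
  obtain ⟨ψ, hψ⟩ := A.exists_polarization_form_apply_ι hpol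
  exact ⟨ψ, hψ, fun χ χ' hne x y hx hy ↦ ψ.baseChange_form_eq_zero_of_mem_eigenspaceBaseChange_of_ne K' A hψ hne hx hy⟩

/-- **`ψ_{K'} = ⊕_s ψ_{K'}|_{V_{K',τ s}}`** («`φ = φ₁ ⊕ ⋯ ⊕ φ_t`») for some polarization `ψ`, when `K'` admits `[K:ℚ]` distinct
embeddings `τ_s` of `K` (so that `K' ⊗ V = ⊕_s V_{K',τ_s}`, `π_s` the block projectors).
[cite: Milne1999LefschetzClasses, §2 p. 647 L1–L4 and p. 649 L1–L8] [cite: Totaro2015HodgeStructuresN00N, §2 Lemma 2.1 (arXiv p0005)] -/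
theorem exists_polarization_baseChange_form_eq_sum_blocks (K' : Type w) [Field K'] [Algebra ℚ K'] {S : Type*} [Fintype S]
    (τ : S → (K →ₐ[ℚ] K')) (hτ : Function.Injective τ) (hcard : Fintype.card S = finrank ℚ K) (hpol : H.IsPolarizable) :
    ∃ ψ : Polarization H, (∀ (u : K) (v w : V), ψ.form (A.ι u v) w = ψ.form v (A.ι u w)) ∧
      ∀ x y : K' ⊗[ℚ] V, ψ.form.baseChange K' x y =
        ∑ s, ψ.form.baseChange K' (A.eigenprojBaseChange K' τ s x) (A.eigenprojBaseChange K' τ s y) := by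
  obtain ⟨ψ, hψ⟩ := A.exists_polarization_form_apply_ι hpol
  exact ⟨ψ, hψ, fun x y ↦ ψ.baseChange_form_eq_sum_blocks K' A τ hτ hcard hψ x y⟩

end Existence

/-! ## §3 The transfer `Ψ : V × V → K` is a `(-1)ⁿ`-symmetric `K`-bilinear form -/

section Transfer

variable [IsTotallyReal K] (A : EndAction H K)

/-- **TOTARO'S `(-1)^m`-HERMITIAN FORM IS `K`-BILINEAR FOR `K` TOTALLY REAL — hypothesis-free.** For every polarizable `ℚ`-Hodge
structure of weight `n` with an action of a totally real field `K` there is a polarization `ψ` (`K`-balanced, Lemma 2.1) whose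
transfer `Ψ = ψ.hermitianTransfer A : V × V → K` — the unique pairing, `K`-linear in the first variable, with `Tr_{K/ℚ} ∘ Ψ = ψ` —
satisfies «`(ax,y) = a(x,y)`, `(x,ay) = a(x,y)`, `(x,y) = (-1)^m (y,x)`»: it is a `(-1)ⁿ`-symmetric `K`-BILINEAR form (Milne's type I
«skew-symmetric and `Fᵢ`-bilinear» `φ` in odd weight). [cite: Totaro2015HodgeStructuresN00N, §2 (arXiv p0004: «thus (,) is a bilinear
form if E is totally real») and Lemma 2.1 (p0005)] [cite: Milne1999LefschetzClasses, §2 p. 646 L38–L42 and p. 648 L37–L55] -/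
theorem exists_polarization_hermitianTransfer_bilinear (hpol : H.IsPolarizable) :
    ∃ ψ : Polarization H, (∀ (u : K) (v w : V), ψ.form (A.ι u v) w = ψ.form v (A.ι u w)) ∧
      (∀ v w : V, Algebra.trace ℚ K (ψ.hermitianTransfer A v w) = ψ.form v w) ∧
      (∀ (a : K) (v w : V), ψ.hermitianTransfer A (A.ι a v) w = a * ψ.hermitianTransfer A v w) ∧
      (∀ (a : K) (v w : V), ψ.hermitianTransfer A v (A.ι a w) = a * ψ.hermitianTransfer A v w) ∧
      (∀ v w : V, ψ.hermitianTransfer A w v = (((n.negOnePow : ℤˣ) : ℤ) : ℚ) • ψ.hermitianTransfer A v w) := by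
  obtain ⟨ψ, hψ⟩ := A.exists_polarization_form_apply_ι hpol
  exact ⟨ψ, hψ, fun v w ↦ ψ.trace_hermitianTransfer A v w, fun a v w ↦ ψ.hermitianTransfer_apply_left A a v w,
    fun a v w ↦ ψ.hermitianTransfer_apply_right_of_forall_form_ι A hψ a v w,
    fun v w ↦ ψ.hermitianTransfer_swap_of_forall_form_ι A hψ v w⟩

/-- The same with NONDEGENERACY of `Ψ` on a finite-dimensional `V` («`φᵢ` is a nondegenerate skew-symmetric form on the
`Fᵢ`-vector space `Vᵢ`»). [cite: Milne1999LefschetzClasses, §2 p. 648 L48–L55] [cite: Totaro2015HodgeStructuresN00N, §2 (arXiv p0004–p0005)] -/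
theorem exists_polarization_hermitianTransfer_bilinear_nondegenerate [Module.Finite ℚ V] (hpol : H.IsPolarizable) :
    ∃ ψ : Polarization H, (∀ (u : K) (v w : V), ψ.form (A.ι u v) w = ψ.form v (A.ι u w)) ∧
      (ψ.hermitianTransfer A).Nondegenerate ∧
      (∀ (a : K) (v w : V), ψ.hermitianTransfer A v (A.ι a w) = a * ψ.hermitianTransfer A v w) ∧
      (∀ v w : V, ψ.hermitianTransfer A w v = (((n.negOnePow : ℤˣ) : ℤ) : ℚ) • ψ.hermitianTransfer A v w) := by
  obtain ⟨ψ, hψ⟩ := A.exists_polarization_form_apply_ι hpol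
  exact ⟨ψ, hψ, ψ.hermitianTransfer_nondegenerate A, fun a v w ↦ ψ.hermitianTransfer_apply_right_of_forall_form_ι A hψ a v w,
    fun v w ↦ ψ.hermitianTransfer_swap_of_forall_form_ι A hψ v w⟩

end Transfer

end EndAction

end Literature.AlgebraicGeometry.Motives.HodgeStructure

end
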